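import Literature.AlgebraicGeometry.Frobenioids.PadicKummerSettingProofs
import Literature.AlgebraicGeometry.Frobenioids.PadicKummerGalois
import HarnessLib

/-!
# Frobenioids II, Definition 2.2 (i) / Remark 2.4.1: the natural action of `G` as an automorphism of
# the Definition 2.2 context; the `(G)_A/(H)_A`-indeterminacy of the comparison data

Mochizuki, *The geometry of Frobenioids II*, Kyushu J. Math. **62** (2008) 401–460, §2: Definition
2.2 (i) p. 17 ("the homomorphism `G ↠ G_A` is only determined up to composition with an inner
automorphism"), Theorem 2.4 (i) p. 20 ("compatible … with the various natural actions of
`(G₁)_{A₁}/(H₁)_{A₁}`, `(G₂)_{A₂}/(H₂)_{A₂}`"), Remark 2.4.1 p. 22 ("so long as one allows for a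
`(Gᵢ)_{Aᵢ}/(Hᵢ)_{Aᵢ}`-indeterminacy") [cite: MochizukiFrdII2008, Rmk 2.4.1 p.22].

Companion (seat abc-iut-L1-d4, gen 2) to abc-iut-L1-t7's `PadicKummerContextIso.lean`: for a
context `X` and `g ∈ G` together with a lift `α ∈ Aut_C(A)` of `outer g ∈ Aut_E(A_E)` (available
whenever `G_A ⥲ Aut_E(A_E)`, e.g. `res = id` at abc-iut-L1-t7's `ofGaloisQuot`/`ofLocalField`), the
natural action of `g` — conjugation by `α` on `Aut_C(A)`, the action of `outer g` on `O^□(A)`,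
conjugation by `outer g` on `Aut_E(A_E)`, conjugation by `g` on `G` — IS an isomorphism of contexts
`Iso.conj X g α hα : X.Iso X` (CONSTRUCTED; `H ↦ H` by normality). Consequences, via the transport
of `PadicKummerIsoTransport.lean` / `PadicKummerSettingProofs.lean`: the comparison data of a
context isomorphism `e` and of `e` followed by the action of `g ∈ G₂` differ exactly by `g` —
a NON-trivial instance of abc-iut-L1-t7's `Rmk241Indeterminacy` schema (`rmk241Indeterminacy_conj`),
which is the finite-level content of Remark 2.4.1; and at `ofGaloisQuot` every `g ∈ G_K` acts
(`Iso.conjOfGaloisQuot`). Nothing here concerns [IUTchIII]; no statement of abc-iut-L1-t7 is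
restated.
-/

namespace Literature.AlgebraicGeometry.Frobenioids

namespace PadicKummer

open Kummer

namespace Def22Context

/-- Conjugation by `g` on the topological group `G`, as an isomorphism of topological groups.
[cite: MochizukiFrdII2008, Def 2.2 (i) p.17] -/
def conjG (X : Def22Context) (g : X.G) : X.G ≃ₜ* X.G :=
  { (MulAut.conj g : X.G ≃* X.G) with
    continuous_toFun := (continuous_const.mul continuous_id).mul continuous_const
    continuous_invFun := (continuous_const.mul continuous_id).mul continuous_const }

/-- `conjG g x = g x g⁻¹`. [cite: MochizukiFrdII2008, Def 2.2 (i) p.17] -/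
@[simp] theorem conjG_apply (X : Def22Context) (g x : X.G) : X.conjG g x = g * x * g⁻¹ := rfl

namespace Iso

variable (X : Def22Context) (g : X.G) (α : X.AutC) (hα : X.res α = X.outer g)

/-- **The natural action of `g ∈ G` on the Definition 2.2 context is a context automorphism**
(Def. 2.2 (i) p. 17; Thm. 2.4 (i) p. 20 "the various natural actions of `(Gᵢ)_{Aᵢ}/(Hᵢ)_{Aᵢ}`"):
given a lift `α ∈ Aut_C(A)` of `outer g`, conjugation by `α` / the action of `outer g` on `O^□(A)` /
conjugation by `outer g` / conjugation by `g` form an `Iso X X`.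
[cite: MochizukiFrdII2008, Thm 2.4 (i) p.20] -/
noncomputable def conj : X.Iso X where
  isoC := MulAut.conj α
  isoO := MulDistribMulAction.toMulEquiv X.O (X.outer g)
  isoE := MulAut.conj (X.outer g)
  isoG := X.conjG g
  res_isoC a := by
    rw [MulAut.conj_apply, MulAut.conj_apply, map_mul, map_mul, map_inv, hα]
  isoO_smul τ x := by
    rw [MulDistribMulAction.toMulEquiv_apply, MulDistribMulAction.toMulEquiv_apply,
      MulAut.conj_apply, smul_smul, smul_smul, inv_mul_cancel_right]
  outer_isoG x := by
    change X.outer (g * x * g⁻¹) = X.outer g * X.outer x * (X.outer g)⁻¹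
    rw [map_mul, map_mul, map_inv]
  map_H := by
    ext x
    constructor
    · rintro ⟨h, hh, rfl⟩
      exact X.normalH.conj_mem h hh g
    · intro hx
      refine ⟨g⁻¹ * x * g⁻¹⁻¹, X.normalH.conj_mem x hx g⁻¹, ?_⟩
      change g * (g⁻¹ * x * g⁻¹⁻¹) * g⁻¹ = x
      group
  isGalois_iff := Iff.rfl

/-- `(conj X g α hα).isoO` is the action of `outer g`. [cite: MochizukiFrdII2008, Thm 2.4 (i) p.20] -/
@[simp] theorem conj_isoO_apply (x : X.O) : (conj X g α hα).isoO x = X.outer g • x := rfl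

/-- `(conj X g α hα).isoE` is conjugation by `outer g`. [cite: MochizukiFrdII2008, Thm 2.4 (i) p.20] -/
@[simp] theorem conj_isoE_apply (τ : X.AutE) :
    (conj X g α hα).isoE τ = X.outer g * τ * (X.outer g)⁻¹ := rfl

/-- `(conj X g α hα).isoG` is conjugation by `g`. [cite: MochizukiFrdII2008, Thm 2.4 (i) p.20] -/
@[simp] theorem conj_isoG_apply (x : X.G) : (conj X g α hα).isoG x = g * x * g⁻¹ := rfl

/-- `(conj X g α hα).isoHA` is conjugation by `outer g` on `H_A`.
[cite: MochizukiFrdII2008, Thm 2.4 (i) p.20] -/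
theorem coe_conj_isoHA (k : X.HA) :
    (((conj X g α hα).isoHA k : X.HA) : X.AutE) = X.outer g * k * (X.outer g)⁻¹ := by
  rw [coe_isoHA, conj_isoE_apply]

/-! ### Remark 2.4.1: comparison data differing by the action of `g ∈ G₂` -/

variable {X₁ X₂ : Def22Context} (e : X₁.Iso X₂) (g₂ : X₂.G) (α₂ : X₂.AutC)
  (hα₂ : X₂.res α₂ = X₂.outer g₂)

/-- **Remark 2.4.1, finite-level content, NON-trivial instance** (FrdII p. 22): the comparison data
induced (at level `N'`) by a context isomorphism followed by the natural action of `g₂ ∈ G₂`, and the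
data induced (at level `N`) by the isomorphism itself, agree up to the `(G₂)_{A₂}/(H₂)_{A₂}`-
indeterminacy given by `g₂` — abc-iut-L1-t7's `Rmk241Indeterminacy` schema, witnessed by `g₂`.
[cite: MochizukiFrdII2008, Rmk 2.4.1 p.22] -/
theorem rmk241Indeterminacy_conj (N N' : ℕ) :
    Rmk241Indeterminacy X₁ X₂ (e.thm24Data N) ((e.trans (conj X₂ g₂ α₂ hα₂)).thm24Data N') :=
  ⟨g₂, fun x => rfl, fun k => by
    change X₂.outer g₂ * e.isoE k * (X₂.outer g₂)⁻¹ =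
      X₂.outer g₂ * ((e.isoHA k : X₂.HA) : X₂.AutE) * (X₂.outer g₂)⁻¹
    rw [coe_isoHA]⟩

/-- Consequently (Thm. 2.4 (i) transport applied to the composite isomorphism) the data twisted by
`g₂` again satisfy all clauses of `Thm24iActionCompat`, and — by `thm24i_of_inputs` — of `Thm24i`
under the same named inputs: the indeterminacy is harmless, as Remark 2.4.1 asserts.
[cite: MochizukiFrdII2008, Rmk 2.4.1 p.22] -/
theorem thm24iActionCompat_conj (N : ℕ) :
    Thm24iActionCompat X₁ X₂ N ((e.trans (conj X₂ g₂ α₂ hα₂)).thm24Data N) :=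
  (e.trans (conj X₂ g₂ α₂ hα₂)).thm24iActionCompat N

end Iso

/-! ### At `ofGaloisQuot` (`Aut_C(A) = Gal(L/K)`, `res = id`): every `g ∈ G_K` acts -/

section GaloisQuot

open Field
open Literature.NumberTheory.GaloisRepresentations

variable {K : Type} [Field K] (L : IntermediateField K (AlgebraicClosure K)) [Normal K L]
  [FiniteDimensional K L]
  (H : Subgroup (absoluteGaloisGroup K)) [H.Normal] (hH : IsOpen (H : Set (absoluteGaloisGroup K)))
  (O : Type) [CommMonoid O] [IsCancelMul O] [MulDistribMulAction (L ≃ₐ[K] L) O]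

/-- At abc-iut-L1-t7's `ofGaloisQuot` (and hence `ofLocalField`), where `Aut_C(A) = Gal(L/K)` and
`res = id`, the lift of `outer g = resGal L g` is `resGal L g` itself: every `g ∈ G_K` acts on the
context by a context automorphism. [cite: MochizukiFrdII2008, Def 2.2 (i) p.17] -/
noncomputable def Iso.conjOfGaloisQuot (g : absoluteGaloisGroup K) :
    (ofGaloisQuot L H hH O).Iso (ofGaloisQuot L H hH O) :=
  Iso.conj (ofGaloisQuot L H hH O) g (resGal L g) rfl

end GaloisQuot

end Def22Context

end PadicKummer

end Literature.AlgebraicGeometry.Frobenioids
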